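import Mathlib
import Literature.MathematicalPhysics.QuantumFieldTheory.Luscher2010.FlowExistenceProofs
import Summits.Ventures.LatticeQCDFlow.TrivializingMaps.JacobianFormula
import Summits.Ventures.LatticeQCDFlow.TrivializingMaps.DefectLogWeightMeasure
import HarnessLib

/-!
# LatticeQCDFlow / TrivializingMaps — the push-forward of `D[V]` under a flow map has a continuous,
# strictly positive density: Lüscher's Jacobian formula (3.9) read backwards

HONEST FRAMING: exact (Metropolis-corrected) sampling algorithms for lattice gauge theory; figures of merit are
autocorrelation/cost numbers at stated couplings and volumes; no continuum-physics claim.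

Venture `LatticeQCDFlow` (cell pub-lqcd), topic `TrivializingMaps`, theory-1 row 28 (successor item N11 of
the statement audit `THEORY-1-STATEMENT-AUDIT.md` R2).  The venture Statement Parts T9
(`truncatedFlow_abs_cov_boltzmann_le_of_meanAccept`) and T16(i)
(`Curve.Gauge.abs_cov_boltzmann_le_curve_of_meanAccept`) — the acceptance–footprint laws of exact flow
samplers — CARRY the hypotheses "`Φ_t` is measurable" and "the proposal law `(Φ_t)_* D[V]` has a density
`q ≥ 0` with respect to `D[U]`".  For the integrated transformation `Φ` of ANY jointly `C¹` generator `Z`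
tangent to the field manifold `SU(n)^E` (Lüscher §3.1) both are THEOREMS, proved here for every real `t`:

* `exists_reverse_flowMap`, `exists_continuous_inverse_flowMap`, `flowMap_bijective` — "the flow equation
  can be integrated backwards" (§3.2): the flow `Φʳ` of the reversed generator `Zʳ_s = -Z_{t-s}` satisfies
  `Φʳ_s ∘ Φ_t = Φ_{t-s}` and `Φ_s ∘ Φʳ_t = Φʳ_{t-s}`, so `Φʳ_t` is a continuous two-sided inverse of `Φ_t`
  (the tree had this only for gradient generators at `t = 1`, `exists_continuous_inverse_flowMap_one`);
* `exists_flowMap_pushforward_density` — **`(Φ_t)_* D[V] = q_t · D[U]` with `q_t` continuous, `q_t > 0`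
  and `q_t(Φ_t V) = exp(-∫₀ᵗ ∑_{x,μ,a} ∂ᵃ_{x,μ}[Z_s]ᵃ(Φ_s V) ds) = 1 / det Φ_{t*}(V)`** — eq. (3.9) applied
  to `(Zʳ, Φʳ)` and tested against `f ∘ Φ_t`, then the substitution `s ↦ t - s`; the displayed formula is
  the proposal density a flow sampler actually evaluates (the Jacobian accumulated along the FORWARD
  trajectory of the proposed field), and it determines `q_t` because `Φ_t` is onto;
* `measurable_flowMap_and_exists_density` — the literal hypotheses `Measurable (Φ t)`, `0 ≤ q`,
  `Measurable q`, `map (Φ t) D[V] = D[V].withDensity (ofReal ∘ q)` of T9 / T16(i), discharged.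

Inputs, all tree theorems by name: Lüscher §3.1 global existence/uniqueness `flowGlobalExistence_holds`
(Literature `Luscher2010/FlowExistenceProofs`), eq. (3.9) `jacobianFormula_holds` (`JacobianFormula.lean`),
`continuous_of_isFlowMap` / `continuous_jacobianWeight` (`JacobianDensity.lean`), and the separation of
finite Borel measures on the compact metrizable field manifold by bounded continuous observables
`map_trivialMeasure_eq_withDensity` (`DefectLogWeightMeasure.lean`).  No `def`, no `sorry`.

References: M. Lüscher, Trivializing maps, the Wilson flow and the HMC algorithm, CMP 293 (2010) 899
[Luscher2010Trivializing, arXiv:0907.5491], §3.1 (after eq. (3.3)), §3.2 eqs. (3.4)–(3.9).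
-/

namespace Summit.Ventures.LatticeQCDFlow.TrivializingMaps

open MeasureTheory
open Literature.MathematicalPhysics.QuantumFieldTheory
open Literature.MathematicalPhysics.QuantumFieldTheory.Luscher2010
open scoped Matrix Matrix.Norms.Frobenius ContDiff BoundedContinuousFunction

variable {d L n : ℕ}

/-! ## §1. Time reversal about an arbitrary base time `t` -/

section Reversal

/-- **Time reversal of flow lines about `t`**: if `U` is a flow line of `Z` then `s ↦ U(t-s)` is a flow
line of the reversed generator `(s, W) ↦ -Z_{t-s}(W)` ("the flow equation can be integrated backwards",
§3.2). [cite: Luscher2010Trivializing, §3.2] -/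
theorem isFlowLine_reverse_sub {Z : Generator d L n} {U : ℝ → AmbConfig d L n} (hU : IsFlowLine Z U)
    (t : ℝ) : IsFlowLine (fun s W => -Z (t - s) W) (fun s => U (t - s)) := by
  intro s e i j
  have h := HasDerivAt.comp_const_sub t s (hU (t - s) e i j)
  refine h.congr_deriv ?_
  simp only [Pi.neg_apply, neg_mul, Matrix.neg_apply]

/-- The reversed generator `(s, W) ↦ -Z_{t-s}(W)` of a jointly `C¹` generator is jointly `C¹` (the
hypothesis of `FlowGlobalExistence` / `JacobianFormula`). [cite: Luscher2010Trivializing, §3.1] -/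
theorem contDiff_one_reverse_sub [NeZero L] {Z : Generator d L n}
    (hZ1 : ContDiff ℝ 1 fun p : ℝ × AmbConfig d L n => Z p.1 p.2) (t : ℝ) :
    ContDiff ℝ 1 fun p : ℝ × AmbConfig d L n => -Z (t - p.1) p.2 :=
  (hZ1.comp ((contDiff_const.sub contDiff_fst).prodMk contDiff_snd)).neg

/-- The reversed generator of a tangent generator is tangent to `SU(n)^E` (`𝔰𝔲(n)` is closed under
negation). [cite: Luscher2010Trivializing, §3.1] -/
theorem isTangent_reverse_sub {Z : Generator d L n} (hZtan : Z.IsTangent) (t : ℝ) :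
    Generator.IsTangent (fun s W => -Z (t - s) W) := fun s U e =>
  Submodule.neg_mem _ (hZtan (t - s) U e)

/-- The coordinates `Zᵃ = -2 Re tr(Tᵃ Z)` are odd. [cite: Luscher2010Trivializing, App. A.3 eq. (A.10)] -/
theorem suBasis_coord_neg (B : SuBasis n) (a : B.ι) (M : Matrix (Fin n) (Fin n) ℂ) :
    B.coord a (-M) = -B.coord a M := by
  simp only [SuBasis.coord, mul_neg, Matrix.trace_neg, Complex.neg_re]

/-- The divergence `∑_{x,μ,a} ∂ᵃ_{x,μ} [Z]ᵃ(x,μ)` is odd in the vector field (no differentiability needed).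
[cite: Luscher2010Trivializing, §3.2 eq. (3.9)] -/
theorem linkDiv_neg [NeZero L] (B : SuBasis n) (Z : AmbConfig d L n → AmbConfig d L n)
    (W : AmbConfig d L n) : linkDiv B (fun W' => -Z W') W = -linkDiv B Z W := by
  unfold linkDiv
  simp only [Pi.neg_apply, suBasis_coord_neg, linkDeriv_neg', Finset.sum_neg_distrib]

end Reversal

/-! ## §2. Inversion of the flow map by backward integration -/

section Inverse

variable [NeZero L]

/-- **Backward integration** (§3.2: "the transformation is invertible … because the flow equation can be
integrated backwards from `t` to `0`"): for a jointly `C¹` tangent generator `Z` with flow map `Φ` and any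
base time `t`, the flow map `Φʳ` of the reversed generator `Zʳ_s = -Z_{t-s}` exists, is jointly continuous,
and satisfies `Φʳ_s(Φ_t V) = Φ_{t-s}(V)` and `Φ_s(Φʳ_t U) = Φʳ_{t-s}(U)` for all `s` (uniqueness of flow
lines, §3.1). [cite: Luscher2010Trivializing, §3.1, §3.2] -/
theorem exists_reverse_flowMap {Z : Generator d L n}
    (hZ1 : ContDiff ℝ 1 fun p : ℝ × AmbConfig d L n => Z p.1 p.2) (hZtan : Z.IsTangent)
    {Φ : ℝ → GaugeConfig d L (Matrix.specialUnitaryGroup (Fin n) ℂ) →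
      GaugeConfig d L (Matrix.specialUnitaryGroup (Fin n) ℂ)} (hΦ : IsFlowMap Z Φ) (t : ℝ) :
    ∃ Φr : ℝ → GaugeConfig d L (Matrix.specialUnitaryGroup (Fin n) ℂ) →
        GaugeConfig d L (Matrix.specialUnitaryGroup (Fin n) ℂ),
      IsFlowMap (fun s W => -Z (t - s) W) Φr ∧
      Continuous (fun p : ℝ × GaugeConfig d L (Matrix.specialUnitaryGroup (Fin n) ℂ) => Φr p.1 p.2) ∧
      (∀ s V, Φr s (Φ t V) = Φ (t - s) V) ∧ ∀ s U, Φ s (Φr t U) = Φr (t - s) U := by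
  have hGE : FlowGlobalExistence d L n := flowGlobalExistence_holds
  obtain ⟨-, huniq⟩ := isFlowMap_continuous_unique hGE hZ1 hZtan hΦ
  obtain ⟨Φr, hΦr, hcontr, huniqr⟩ :=
    hGE (fun s W => -Z (t - s) W) (contDiff_one_reverse_sub hZ1 t) (isTangent_reverse_sub hZtan t)
  refine ⟨Φr, hΦr, hcontr, fun s V => ?_, fun s U₀ => ?_⟩
  · have hrev : IsFlowLine (fun s W => -Z (t - s) W)
        (fun s => WilsonFlow.coeConfig (Φ (t - s) V)) := isFlowLine_reverse_sub (hΦ.2 V) t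
    have h0 : (fun s => WilsonFlow.coeConfig (Φ (t - s) V)) 0 = WilsonFlow.coeConfig (Φ t V) := by
      show WilsonFlow.coeConfig (Φ (t - 0) V) = _
      rw [sub_zero]
    exact (WilsonFlow.coeConfig_injective (huniqr _ (Φ t V) hrev h0 s)).symm
  · have hrev' : IsFlowLine Z (fun s => WilsonFlow.coeConfig (Φr (t - s) U₀)) :=
      isFlowLine_congr_generator (isFlowLine_reverse_sub (hΦr.2 U₀) t) fun s W => by
        simp only [sub_sub_cancel, neg_neg]
    have h0 : (fun s => WilsonFlow.coeConfig (Φr (t - s) U₀)) 0 = WilsonFlow.coeConfig (Φr t U₀) := by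
      show WilsonFlow.coeConfig (Φr (t - 0) U₀) = _
      rw [sub_zero]
    exact (WilsonFlow.coeConfig_injective (huniq _ (Φr t U₀) hrev' h0 s)).symm

/-- **The flow map `Φ_t` has a continuous two-sided inverse** (namely `Φʳ_t`), for every jointly `C¹`
tangent generator and every real `t` — the tree's `exists_continuous_inverse_flowMap_one` (gradient
generators, `t = 1`) in full generality. [cite: Luscher2010Trivializing, §3.2] -/
theorem exists_continuous_inverse_flowMap {Z : Generator d L n}
    (hZ1 : ContDiff ℝ 1 fun p : ℝ × AmbConfig d L n => Z p.1 p.2) (hZtan : Z.IsTangent)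
    {Φ : ℝ → GaugeConfig d L (Matrix.specialUnitaryGroup (Fin n) ℂ) →
      GaugeConfig d L (Matrix.specialUnitaryGroup (Fin n) ℂ)} (hΦ : IsFlowMap Z Φ) (t : ℝ) :
    ∃ Ψ : GaugeConfig d L (Matrix.specialUnitaryGroup (Fin n) ℂ) →
        GaugeConfig d L (Matrix.specialUnitaryGroup (Fin n) ℂ),
      Continuous Ψ ∧ (∀ V, Ψ (Φ t V) = V) ∧ ∀ U, Φ t (Ψ U) = U := by
  obtain ⟨Φr, hΦr, hcontr, hl, hr⟩ := exists_reverse_flowMap hZ1 hZtan hΦ t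
  refine ⟨Φr t, hcontr.comp (continuous_const.prodMk continuous_id), fun V => ?_, fun U => ?_⟩
  · rw [hl, sub_self, hΦ.1]
  · rw [hr, sub_self, hΦr.1]

/-- `Φ_t` is a bijection of the field manifold `SU(n)^E` (a homeomorphism, both maps being continuous).
[cite: Luscher2010Trivializing, §3.2] -/
theorem flowMap_bijective {Z : Generator d L n}
    (hZ1 : ContDiff ℝ 1 fun p : ℝ × AmbConfig d L n => Z p.1 p.2) (hZtan : Z.IsTangent)
    {Φ : ℝ → GaugeConfig d L (Matrix.specialUnitaryGroup (Fin n) ℂ) →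
      GaugeConfig d L (Matrix.specialUnitaryGroup (Fin n) ℂ)} (hΦ : IsFlowMap Z Φ) (t : ℝ) :
    Function.Bijective (Φ t) := by
  obtain ⟨Ψ, -, hl, hr⟩ := exists_continuous_inverse_flowMap hZ1 hZtan hΦ t
  exact ⟨Function.LeftInverse.injective hl, Function.RightInverse.surjective hr⟩

end Inverse

/-! ## §3. The push-forward density -/

section Density

variable [NeZero L]

/-- **`(Φ_t)_* D[V]` has a continuous, strictly positive density — eq. (3.9) read backwards** (OURS; the
statement audit's item N11): for every jointly `C¹` tangent generator `Z` on `SU(n)^E`, every flow map `Φ`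
of `Z` and every real `t` there is `q : SU(n)^E → ℝ`, continuous, `q > 0`, with
`map (Φ t) D[V] = q · D[U]` and, on the range of `Φ_t` (which is everything),
`q(Φ_t V) = exp(-∫₀ᵗ ∑_{x,μ,a} ∂ᵃ_{x,μ}[Z_s]ᵃ(Φ_s V) ds) = 1/det Φ_{t*}(V)` — the proposal density of the
exact flow sampler, accumulated along the forward trajectory.  Proof: (3.9) for the reversed pair
`(Zʳ, Φʳ)` of `exists_reverse_flowMap` tested against `f ∘ Φ_t` gives `∫ f(Φ_t V) dV = ∫ f(U) q(U) dU`
with `q(U) = exp ∫₀ᵗ div Zʳ_s(Φʳ_s U) ds`; bounded continuous `f` separate finite Borel measures; on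
`U = Φ_t V`, `Φʳ_s U = Φ_{t-s} V`, `div(-Z) = -div Z` and `s ↦ t - s`.
[cite: Luscher2010Trivializing, §3.2 eqs. (3.4)–(3.9)] -/
theorem exists_flowMap_pushforward_density (B : SuBasis n) {Z : Generator d L n}
    (hZ1 : ContDiff ℝ 1 fun p : ℝ × AmbConfig d L n => Z p.1 p.2) (hZtan : Z.IsTangent)
    {Φ : ℝ → GaugeConfig d L (Matrix.specialUnitaryGroup (Fin n) ℂ) →
      GaugeConfig d L (Matrix.specialUnitaryGroup (Fin n) ℂ)} (hΦ : IsFlowMap Z Φ) (t : ℝ) :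
    ∃ q : GaugeConfig d L (Matrix.specialUnitaryGroup (Fin n) ℂ) → ℝ,
      Continuous q ∧ (∀ U, 0 < q U) ∧
      (∀ V, q (Φ t V) =
        Real.exp (-∫ s in (0 : ℝ)..t, linkDiv B (Z s) (WilsonFlow.coeConfig (Φ s V)))) ∧
      (trivialMeasure (Matrix.specialUnitaryGroup (Fin n) ℂ) d L).map (Φ t) =
        (trivialMeasure (Matrix.specialUnitaryGroup (Fin n) ℂ) d L).withDensity
          (fun U => ENNReal.ofReal (q U)) := by
  haveI : SecondCountableTopology (Matrix (Fin n) (Fin n) ℂ) :=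
    inferInstanceAs (SecondCountableTopology (Fin n → Fin n → ℂ))
  haveI : SecondCountableTopology (Matrix.specialUnitaryGroup (Fin n) ℂ) :=
    Topology.IsEmbedding.subtypeVal.secondCountableTopology
  have hJ : JacobianFormula d L n := jacobianFormula_holds
  obtain ⟨Φr, hΦr, -, hl, hr⟩ := exists_reverse_flowMap hZ1 hZtan hΦ t
  have hZ1r := contDiff_one_reverse_sub hZ1 t
  have hZtr := isTangent_reverse_sub hZtan t
  have hΦtc : Continuous (Φ t) := continuous_of_isFlowMap hZ1 hΦ t
  -- the density in its "reversed" form `q(U) = exp ∫₀ᵗ div Zʳ_s(Φʳ_s U) ds`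
  obtain ⟨q, hq⟩ : ∃ q : GaugeConfig d L (Matrix.specialUnitaryGroup (Fin n) ℂ) → ℝ, ∀ U, q U =
      Real.exp (∫ s in (0 : ℝ)..t, linkDiv B (fun W => -Z (t - s) W)
        (WilsonFlow.coeConfig (Φr s U))) := ⟨_, fun U => rfl⟩
  have hq' : q = fun U => Real.exp (∫ s in (0 : ℝ)..t, linkDiv B ((fun s W => -Z (t - s) W) s)
      (WilsonFlow.coeConfig (Φr s U))) := funext hq
  have hqc : Continuous q := by
    rw [hq']
    exact continuous_jacobianWeight B hZ1r hΦr t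
  -- (3.9) for `(Zʳ, Φʳ)` tested against `f ∘ Φ_t`
  have key : ∀ f : GaugeConfig d L (Matrix.specialUnitaryGroup (Fin n) ℂ) →ᵇ ℝ,
      ∫ U, f U * q U ∂(trivialMeasure (Matrix.specialUnitaryGroup (Fin n) ℂ) d L) =
        ∫ V, f (Φ t V) ∂(trivialMeasure (Matrix.specialUnitaryGroup (Fin n) ℂ) d L) := by
    intro f
    have hO : Continuous fun V => f (Φ t V) := f.continuous.comp hΦtc
    rw [hJ B (fun s W => -Z (t - s) W) Φr hZ1r hZtr hΦr t (fun V => f (Φ t V)) hO]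
    refine integral_congr_ae (Filter.Eventually.of_forall fun U => ?_)
    show f U * q U = f (Φ t (Φr t U)) * _
    rw [hr, sub_self, hΦr.1, hq]
  have hmap := map_trivialMeasure_eq_withDensity hΦtc.measurable hqc
    (fun U => by rw [hq]; exact (Real.exp_pos _).le) key
  refine ⟨q, hqc, fun U => by rw [hq]; exact Real.exp_pos _, fun V => ?_, hmap⟩
  -- the sampler-side formula on `U = Φ_t V`
  rw [hq]
  congr 1
  have hpt : ∀ s, linkDiv B (fun W => -Z (t - s) W) (WilsonFlow.coeConfig (Φr s (Φ t V))) =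
      -linkDiv B (Z (t - s)) (WilsonFlow.coeConfig (Φ (t - s) V)) := fun s => by
    rw [linkDiv_neg, hl]
  simp_rw [hpt, intervalIntegral.integral_neg]
  rw [intervalIntegral.integral_comp_sub_left
    (fun u => linkDiv B (Z u) (WilsonFlow.coeConfig (Φ u V))) t, sub_self, sub_zero]

/-- **The carried hypotheses of T9 / T16(i), discharged**: for the flow map of any jointly `C¹` tangent
generator and any real `t`, `Φ_t` is measurable and `(Φ_t)_* D[V] = D[V].withDensity (ofReal ∘ q)` for some
measurable `q ≥ 0` (indeed continuous and `> 0`, `exists_flowMap_pushforward_density`) — literally the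
hypotheses `hΦm`, `hq0`, `hqm`, `hν` of `truncatedFlow_abs_cov_boltzmann_le_of_meanAccept` (T9) and of
`Curve.Gauge.abs_cov_boltzmann_le_curve_of_meanAccept` (T16(i)). [cite: Luscher2010Trivializing, §3.2 eq. (3.9)] -/
theorem measurable_flowMap_and_exists_density (B : SuBasis n) {Z : Generator d L n}
    (hZ1 : ContDiff ℝ 1 fun p : ℝ × AmbConfig d L n => Z p.1 p.2) (hZtan : Z.IsTangent)
    {Φ : ℝ → GaugeConfig d L (Matrix.specialUnitaryGroup (Fin n) ℂ) →
      GaugeConfig d L (Matrix.specialUnitaryGroup (Fin n) ℂ)} (hΦ : IsFlowMap Z Φ) (t : ℝ) :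
    Measurable (Φ t) ∧
      ∃ q : GaugeConfig d L (Matrix.specialUnitaryGroup (Fin n) ℂ) → ℝ, (∀ U, 0 ≤ q U) ∧ Measurable q ∧
        (trivialMeasure (Matrix.specialUnitaryGroup (Fin n) ℂ) d L).map (Φ t) =
          (trivialMeasure (Matrix.specialUnitaryGroup (Fin n) ℂ) d L).withDensity
            (fun U => ENNReal.ofReal (q U)) := by
  haveI : SecondCountableTopology (Matrix (Fin n) (Fin n) ℂ) :=
    inferInstanceAs (SecondCountableTopology (Fin n → Fin n → ℂ))
  haveI : SecondCountableTopology (Matrix.specialUnitaryGroup (Fin n) ℂ) :=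
    Topology.IsEmbedding.subtypeVal.secondCountableTopology
  obtain ⟨q, hqc, hq0, -, hmap⟩ := exists_flowMap_pushforward_density B hZ1 hZtan hΦ t
  exact ⟨(continuous_of_isFlowMap hZ1 hΦ t).measurable, q, fun U => (hq0 U).le, hqc.measurable, hmap⟩

/-- **The proposal law of an exact flow sampler is a probability measure equivalent to `D[U]`**: its
density integrates to one. [cite: Luscher2010Trivializing, §2.1 eq. (2.9), §3.2 eq. (3.9)] -/
theorem integral_flowMap_density_eq_one {Z : Generator d L n}
    (hZ1 : ContDiff ℝ 1 fun p : ℝ × AmbConfig d L n => Z p.1 p.2)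
    {Φ : ℝ → GaugeConfig d L (Matrix.specialUnitaryGroup (Fin n) ℂ) →
      GaugeConfig d L (Matrix.specialUnitaryGroup (Fin n) ℂ)} (hΦ : IsFlowMap Z Φ) (t : ℝ)
    {q : GaugeConfig d L (Matrix.specialUnitaryGroup (Fin n) ℂ) → ℝ} (hqc : Continuous q)
    (hq0 : ∀ U, 0 ≤ q U)
    (hmap : (trivialMeasure (Matrix.specialUnitaryGroup (Fin n) ℂ) d L).map (Φ t) =
      (trivialMeasure (Matrix.specialUnitaryGroup (Fin n) ℂ) d L).withDensity
        (fun U => ENNReal.ofReal (q U))) :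
    ∫ U, q U ∂(trivialMeasure (Matrix.specialUnitaryGroup (Fin n) ℂ) d L) = 1 := by
  haveI : SecondCountableTopology (Matrix (Fin n) (Fin n) ℂ) :=
    inferInstanceAs (SecondCountableTopology (Fin n → Fin n → ℂ))
  haveI : SecondCountableTopology (Matrix.specialUnitaryGroup (Fin n) ℂ) :=
    Topology.IsEmbedding.subtypeVal.secondCountableTopology
  haveI : IsProbabilityMeasure (trivialMeasure (Matrix.specialUnitaryGroup (Fin n) ℂ) d L) := by
    unfold trivialMeasure; infer_instance
  have hΦtm : Measurable (Φ t) := (continuous_of_isFlowMap hZ1 hΦ t).measurable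
  have h1 : (trivialMeasure (Matrix.specialUnitaryGroup (Fin n) ℂ) d L).withDensity
      (fun U => ENNReal.ofReal (q U)) Set.univ = 1 := by
    rw [← hmap, Measure.map_apply hΦtm MeasurableSet.univ, Set.preimage_univ, measure_univ]
  rw [withDensity_apply _ MeasurableSet.univ, Measure.restrict_univ] at h1
  rw [integral_eq_lintegral_of_nonneg_ae (Filter.Eventually.of_forall hq0)
    hqc.measurable.aestronglyMeasurable, h1, ENNReal.toReal_one]

end Density

end Summit.Ventures.LatticeQCDFlow.TrivializingMaps
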